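import Mathlib.Algebra.Order.BigOperators.Group.Finset
import Mathlib.Data.Real.Basic
import Mathlib.Tactic.Ring
import Mathlib.Tactic.Linarith
import Mathlib.Tactic.LinearCombination
import HarnessLib

/-!
# `NoHeavyLowerTail` (stmt-CriticalPhenomena-4575) — antithetic cluster pairs: PRODUCT CERTIFICATES, the four-term identity and
# the CHAIN IDENTITY (prim-hp-2 gen 46, THEOREM-FrozenPieces.md §3, MEMO-gen46 §3)

Support file (`--supports stmt-CriticalPhenomena-4575`, hull-port prover `prim-hp-2`, gen 46).  Pure real algebra: no definitions, no
named facts, no sorries; standard axioms.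

A PRODUCT CERTIFICATE for an antithetic form `Σ_t (F a_t − F b_t)(G a_t − G b_t)` is an identity rewriting it as a nonnegative combination
of products `(F p − F q)(G r − G s)` of monotonicity gaps (`q ⊆ p`, `s ⊆ r`); positivity for all increasing `F, G` is then bookkeeping
(CONJECTURE Π of gen 46: every bicluster-avoidance / change form has one; verified by LP on every instance with ≤ 5 vertices and ≤ 6
edges).  This file proves the two identities from which the explicit certificate of THEOREM C (BIC on cycles) is assembled (THEOREM C-Π):

* `Antithetic.ChainCert.four_term` — the FOUR-TERM IDENTITY behind the four-value inequality of THEOREM C′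
  (`Quad.four_value`): `Â·B̂ + (a − a′)(b − b′) = (Â − a′)(B̂ − b′) + (Â − a)·b′ + a′·(B̂ − b) + a·b`, and its nonnegativity
  `four_term_nonneg` under `0 ≤ a, a′ ≤ Â`, `0 ≤ b, b′ ≤ B̂` (one bulk class of a cycle: `Â = F(P ∪ Q)`, `a = F(P)`, `a′ = F(Q)`).
* `Antithetic.ChainCert.chain_identity` — the CHAIN IDENTITY: for reals `e, e'` and sequences `u, u', w, w'`,
  `e e' + Σ_{t ≤ m} (u_t − w_t)(u'_t − w'_t) + Σ_{t < m} (u_t w'_{t+1} + w_{t+1} u'_t)`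
  `= (e − w_0)(e' − w'_0) + Σ_{t ≤ m} u_t u'_t + Σ_{1 ≤ t ≤ m} w_t w'_t + Σ_{t < m} ((w_t − w_{t+1})(e' − u'_t) + (w'_t − w'_{t+1})(e − u_t))`
  `  + w_m (e' − u'_m) + w'_m (e − u_m)`
  (one arc `E` pays for a whole anti-monotone chain of cross pairs `(P_{i_t}, Q_{n−i_t})`, up to the "adjacent debts"
  `u_t w'_{t+1} + w_{t+1} u'_t`), and
* `Antithetic.ChainCert.chain_nonneg` — the CHAIN LEMMA: if moreover arcs `a_t ⊇ P_{i_t} ∪ Q_{n−i_{t+1}}` pay the debts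
  (`u_t, w_{t+1} ≤ a_t`), then `0 ≤ Σ_{t<m} a_t a'_t + e e' + Σ_{t ≤ m} (u_t − w_t)(u'_t − w'_t)` — THEOREM C's boundary lemma BL
  (`BCount`-free), and the building block for hand-made product certificates on θ-graphs and cones.
[cite: VandenbergHaggstromKahn2005, §1 p. 6 ("Harris' inequality")]
-/

namespace Summit.CriticalPhenomena.PercolationContinuityZ3.Theorems

namespace Antithetic

namespace ChainCert

open Finset

/-- **The four-term identity** (gen 46): `Â B̂ + (a − a′)(b − b′) = (Â − a′)(B̂ − b′) + (Â − a) b′ + a′ (B̂ − b) + a b`.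
With `0 ≤ a, a′ ≤ Â` and `0 ≤ b, b′ ≤ B̂` every product on the right is nonnegative: this is the product certificate of the
four-value inequality `Quad.four_value`. [this work] -/
theorem four_term (A B a a' b b' : ℝ) :
    A * B + (a - a') * (b - b') = (A - a') * (B - b') + (A - a) * b' + a' * (B - b) + a * b := by
  ring

/-- The four-value inequality read off the four-term identity: `0 ≤ Â B̂ + (a − a′)(b − b′)` when `0 ≤ a, a′ ≤ Â` and
`0 ≤ b, b′ ≤ B̂`. [this work] -/
theorem four_term_nonneg {A B a a' b b' : ℝ} (ha : 0 ≤ a) (haA : a ≤ A) (ha'A : a' ≤ A) (ha' : 0 ≤ a')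
    (hb : 0 ≤ b) (hbB : b ≤ B) (hb'B : b' ≤ B) (hb' : 0 ≤ b') : 0 ≤ A * B + (a - a') * (b - b') := by
  rw [four_term]
  have h1 : 0 ≤ (A - a') * (B - b') := mul_nonneg (by linarith) (by linarith)
  have h2 : 0 ≤ (A - a) * b' := mul_nonneg (by linarith) hb'
  have h3 : 0 ≤ a' * (B - b) := mul_nonneg ha' (by linarith)
  have h4 : 0 ≤ a * b := mul_nonneg ha hb
  linarith

/-- **The chain identity** (gen 46).  For reals `e, e'` and sequences `u u' w w' : ℕ → ℝ` (think `u t = F(P_{i_t})`,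
`w t = F(Q_{n−i_t})`, `e = F(E)`, primes for `G`), for every `m`:
`e e' + Σ_{t ≤ m} (u_t − w_t)(u'_t − w'_t) + Σ_{t < m} (u_t w'_{t+1} + w_{t+1} u'_t)`
`  = (e − w_0)(e' − w'_0) + Σ_{t ≤ m} u_t u'_t + Σ_{t < m} w_{t+1} w'_{t+1}`
`    + Σ_{t < m} ((w_t − w_{t+1})(e' − u'_t) + (w'_t − w'_{t+1})(e − u_t)) + (w_m (e' − u'_m) + w'_m (e − u_m))`.
(Induction on `m`; pure algebra.) [this work] -/
theorem chain_identity (e e' : ℝ) (u u' w w' : ℕ → ℝ) (m : ℕ) :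
    e * e' + (∑ t ∈ range (m + 1), (u t - w t) * (u' t - w' t))
        + (∑ t ∈ range m, (u t * w' (t + 1) + w (t + 1) * u' t))
      = (e - w 0) * (e' - w' 0) + (∑ t ∈ range (m + 1), u t * u' t) + (∑ t ∈ range m, w (t + 1) * w' (t + 1))
        + (∑ t ∈ range m, ((w t - w (t + 1)) * (e' - u' t) + (w' t - w' (t + 1)) * (e - u t)))
        + (w m * (e' - u' m) + w' m * (e - u m)) := by
  induction m with
  | zero =>
    simp only [zero_add, sum_range_one, range_zero, sum_empty, add_zero]
    ring
  | succ n ih =>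
    rw [sum_range_succ (f := fun t => (u t - w t) * (u' t - w' t)), sum_range_succ (f := fun t => u t * w' (t + 1) + w (t + 1) * u' t),
      sum_range_succ (f := fun t => u t * u' t) (n := n + 1), sum_range_succ (f := fun t => w (t + 1) * w' (t + 1)),
      sum_range_succ (f := fun t => (w t - w (t + 1)) * (e' - u' t) + (w' t - w' (t + 1)) * (e - u t))]
    have key : e * e' + (∑ t ∈ range (n + 1), (u t - w t) * (u' t - w' t))
        + (∑ t ∈ range n, (u t * w' (t + 1) + w (t + 1) * u' t))
        = (e - w 0) * (e' - w' 0) + (∑ t ∈ range (n + 1), u t * u' t) + (∑ t ∈ range n, w (t + 1) * w' (t + 1))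
          + (∑ t ∈ range n, ((w t - w (t + 1)) * (e' - u' t) + (w' t - w' (t + 1)) * (e - u t)))
          + (w n * (e' - u' n) + w' n * (e - u n)) := ih
    linear_combination key

/-- **The chain lemma** (gen 46): one arc `E` and `m` further arcs `A_t` pay for an anti-monotone chain of `m + 1` cross pairs.
Hypotheses (all read off set inclusions in the application `u t = F(P_{i_t})`, `w t = F(Q_{n−i_t})`, `a t = F(A_{k_t})`,
`P_{i_t} ∪ Q_{n−i_{t+1}} ⊆ A_{k_t} ⊆ E`): `0 ≤ u_t ≤ e`, `0 ≤ w_t ≤ e`, `w_{t+1} ≤ w_t`, `u_t ≤ a_t`, `w_{t+1} ≤ a_t` (same with primes).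
Conclusion: `0 ≤ Σ_{t<m} a_t a'_t + e e' + Σ_{t ≤ m} (u_t − w_t)(u'_t − w'_t)`.  Proof: `chain_identity`, and each debt
`u_t w'_{t+1} + w_{t+1} u'_t` is paid by `a_t a'_t` through `four_term` (`a a' − u w'₊ − w₊ u' = (a − w₊)(a' − w'₊) + (a − u) w'₊ +
w₊ (a' − u') − w₊ w'₊`, the last term cancelling the chain's `+ w₊ w'₊`). [this work] -/
theorem chain_nonneg (e e' : ℝ) (u u' w w' a a' : ℕ → ℝ) (m : ℕ)
    (hu : ∀ t, t ≤ m → 0 ≤ u t ∧ u t ≤ e) (hu' : ∀ t, t ≤ m → 0 ≤ u' t ∧ u' t ≤ e')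
    (hw : ∀ t, t ≤ m → 0 ≤ w t ∧ w t ≤ e) (hw' : ∀ t, t ≤ m → 0 ≤ w' t ∧ w' t ≤ e')
    (hwmono : ∀ t, t < m → w (t + 1) ≤ w t) (hw'mono : ∀ t, t < m → w' (t + 1) ≤ w' t)
    (hau : ∀ t, t < m → u t ≤ a t) (haw : ∀ t, t < m → w (t + 1) ≤ a t)
    (hau' : ∀ t, t < m → u' t ≤ a' t) (haw' : ∀ t, t < m → w' (t + 1) ≤ a' t) :
    0 ≤ (∑ t ∈ range m, a t * a' t) + (e * e' + ∑ t ∈ range (m + 1), (u t - w t) * (u' t - w' t)) := by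
  -- add and subtract the debts
  have hid := chain_identity e e' u u' w w' m
  -- the debt-paying identity for each arc
  have harc : ∀ t, t < m →
      0 ≤ a t * a' t - (u t * w' (t + 1) + w (t + 1) * u' t) + w (t + 1) * w' (t + 1) := by
    intro t ht
    have e1 : a t * a' t - (u t * w' (t + 1) + w (t + 1) * u' t) + w (t + 1) * w' (t + 1)
        = (a t - w (t + 1)) * (a' t - w' (t + 1)) + (a t - u t) * w' (t + 1) + w (t + 1) * (a' t - u' t) := by ring
    rw [e1]
    have h1 : 0 ≤ (a t - w (t + 1)) * (a' t - w' (t + 1)) :=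
      mul_nonneg (by linarith [haw t ht]) (by linarith [haw' t ht])
    have h2 : 0 ≤ (a t - u t) * w' (t + 1) := mul_nonneg (by linarith [hau t ht]) (hw' (t + 1) (by omega)).1
    have h3 : 0 ≤ w (t + 1) * (a' t - u' t) := mul_nonneg (hw (t + 1) (by omega)).1 (by linarith [hau' t ht])
    linarith
  have hsum : 0 ≤ ∑ t ∈ range m, (a t * a' t - (u t * w' (t + 1) + w (t + 1) * u' t) + w (t + 1) * w' (t + 1)) :=
    sum_nonneg fun t ht => harc t (mem_range.1 ht)
  -- the right-hand side of the chain identity minus Σ w₊ w'₊ is a sum of nonnegative products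
  have hR1 : 0 ≤ (e - w 0) * (e' - w' 0) := mul_nonneg (by linarith [(hw 0 (by omega)).2]) (by linarith [(hw' 0 (by omega)).2])
  have hR2 : 0 ≤ ∑ t ∈ range (m + 1), u t * u' t :=
    sum_nonneg fun t ht => mul_nonneg (hu t (by have := mem_range.1 ht; omega)).1 (hu' t (by have := mem_range.1 ht; omega)).1
  have hR3 : 0 ≤ ∑ t ∈ range m, ((w t - w (t + 1)) * (e' - u' t) + (w' t - w' (t + 1)) * (e - u t)) := by
    refine sum_nonneg fun t ht => ?_
    have ht' := mem_range.1 ht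
    have h1 : 0 ≤ (w t - w (t + 1)) * (e' - u' t) :=
      mul_nonneg (by linarith [hwmono t ht']) (by linarith [(hu' t (by omega)).2])
    have h2 : 0 ≤ (w' t - w' (t + 1)) * (e - u t) :=
      mul_nonneg (by linarith [hw'mono t ht']) (by linarith [(hu t (by omega)).2])
    linarith
  have hR4 : 0 ≤ w m * (e' - u' m) + w' m * (e - u m) := by
    have h1 : 0 ≤ w m * (e' - u' m) := mul_nonneg (hw m le_rfl).1 (by linarith [(hu' m le_rfl).2])
    have h2 : 0 ≤ w' m * (e - u m) := mul_nonneg (hw' m le_rfl).1 (by linarith [(hu m le_rfl).2])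
    linarith
  -- bookkeeping: Σ (a a' − debt + w₊w'₊) = Σ a a' − Σ debt + Σ w₊ w'₊
  have hsplit : ∑ t ∈ range m, (a t * a' t - (u t * w' (t + 1) + w (t + 1) * u' t) + w (t + 1) * w' (t + 1))
      = (∑ t ∈ range m, a t * a' t) - (∑ t ∈ range m, (u t * w' (t + 1) + w (t + 1) * u' t))
        + ∑ t ∈ range m, w (t + 1) * w' (t + 1) := by
    rw [← sum_sub_distrib, ← sum_add_distrib]
  rw [hsplit] at hsum
  linarith


/-- **The crossing identity** (gen 46; the algebraic form of THEOREM C′'s incompatibility lemma, THEOREM-Cprime §6): two cross pairs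
`(B₁, s₁)`, `(B₂, s₂)` that CROSS (`s₂ ⊆ B₁`, `s₁ ⊆ B₂`), an arc `E ⊇ B₁, B₂` and an arc `A ⊇ s₁, s₂`:
`E E' + A A' + (b₁ − σ₁)(b₁' − σ₁') + (b₂ − σ₂)(b₂' − σ₂')`
`  = (b₁ − σ₂)(b₂' − σ₁') + (b₂ − σ₁)(b₁' − σ₂') + (E E' + (b₁ − b₂)(b₁' − b₂')) + (A A' + (σ₁ − σ₂)(σ₁' − σ₂'))`
(`b_i = F(B_i)`, `σ_i = F(s_i)`, primes for `G`); the last two brackets are four-term forms (`four_term`). [this work] -/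
theorem crossing_identity (E E' A A' b₁ b₁' σ₁ σ₁' b₂ b₂' σ₂ σ₂' : ℝ) :
    E * E' + A * A' + (b₁ - σ₁) * (b₁' - σ₁') + (b₂ - σ₂) * (b₂' - σ₂')
      = (b₁ - σ₂) * (b₂' - σ₁') + (b₂ - σ₁) * (b₁' - σ₂')
        + (E * E' + (b₁ - b₂) * (b₁' - b₂')) + (A * A' + (σ₁ - σ₂) * (σ₁' - σ₂')) := by
  ring

/-- **The crossing lemma** (gen 46): with `σ₂ ≤ b₁ ≤ E`, `σ₁ ≤ b₂ ≤ E`, `0 ≤ σ₁, σ₂ ≤ A` and `0 ≤ b₁, b₂` (same with primes) — i.e. the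
cross pairs cross, the big sides lie under the arc `E` and the small sides under the arc `A` —
`0 ≤ E E' + A A' + (b₁ − σ₁)(b₁' − σ₁') + (b₂ − σ₂)(b₂' − σ₂')`: ONE arc `E` pays for TWO crossing cross pairs with the help of one
small arc.  (THEOREM C′'s boundary: the `rb` one-change pair `(P_i + e, Q_{n−i})`, `i > q`, and the `br` pair `(Q_{n−k} + e, P_k)`,
`k ≤ p`, always cross; `E + e` and any `A_j + e`, `k ≤ j < i`, are the arcs.) [this work] -/
theorem crossing_nonneg {E E' A A' b₁ b₁' σ₁ σ₁' b₂ b₂' σ₂ σ₂' : ℝ}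
    (h12 : σ₂ ≤ b₁) (h1E : b₁ ≤ E) (h21 : σ₁ ≤ b₂) (h2E : b₂ ≤ E) (hs1 : 0 ≤ σ₁) (hs1A : σ₁ ≤ A) (hs2 : 0 ≤ σ₂)
    (hs2A : σ₂ ≤ A) (hb1 : 0 ≤ b₁) (hb2 : 0 ≤ b₂)
    (h12' : σ₂' ≤ b₁') (h1E' : b₁' ≤ E') (h21' : σ₁' ≤ b₂') (h2E' : b₂' ≤ E') (hs1' : 0 ≤ σ₁') (hs1A' : σ₁' ≤ A')
    (hs2' : 0 ≤ σ₂') (hs2A' : σ₂' ≤ A') (hb1' : 0 ≤ b₁') (hb2' : 0 ≤ b₂') :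
    0 ≤ E * E' + A * A' + (b₁ - σ₁) * (b₁' - σ₁') + (b₂ - σ₂) * (b₂' - σ₂') := by
  rw [crossing_identity]
  have h1 : 0 ≤ (b₁ - σ₂) * (b₂' - σ₁') := mul_nonneg (by linarith) (by linarith)
  have h2 : 0 ≤ (b₂ - σ₁) * (b₁' - σ₂') := mul_nonneg (by linarith) (by linarith)
  have h3 : 0 ≤ E * E' + (b₁ - b₂) * (b₁' - b₂') := four_term_nonneg hb1 h1E h2E hb2 hb1' h1E' h2E' hb2'
  have h4 : 0 ≤ A * A' + (σ₁ - σ₂) * (σ₁' - σ₂') := four_term_nonneg hs1 hs1A hs2A hs2 hs1' hs1A' hs2A' hs2'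
  linarith


/-- **One-sided crossing identity** (gen 46; 7 products — the MILP-minimal certificate of the abstract (1,1) double chain, kit j208208):
`E E' + A A' + (b − σ)(b' − σ') + (c − ζ)(c' − ζ')`
`  = b (A' − σ') + b' (A − σ) + σ σ' + c c' + ζ (E' − c') + ζ' (E − c) + (E − b)(A' − ζ') + (E' − b')(A − ζ) + (E − A)(E' − A') + (b − ζ)(b' − ζ')`.
It needs only ONE crossing (`z ⊆ B`, i.e. `ζ ≤ b`), `s, z ⊆ A ⊆ E` and `B, C ⊆ E`. [this work] -/
theorem crossing_identity_one_sided (E E' A A' b b' σ σ' c c' ζ ζ' : ℝ) :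
    E * E' + A * A' + (b - σ) * (b' - σ') + (c - ζ) * (c' - ζ')
      = b * (A' - σ') + b' * (A - σ) + σ * σ' + c * c' + ζ * (E' - c') + ζ' * (E - c)
        + (E - b) * (A' - ζ') + (E' - b') * (A - ζ) + (E - A) * (E' - A') + (b - ζ) * (b' - ζ') := by
  ring

/-- Nonnegativity from the one-sided crossing identity: `0 ≤ E E' + A A' + (b − σ)(b' − σ') + (c − ζ)(c' − ζ')` when `0 ≤ σ ≤ A ≤ E`,
`0 ≤ ζ ≤ A`, `ζ ≤ b ≤ E`, `0 ≤ c ≤ E` (same with primes). [this work] -/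
theorem crossing_one_sided_nonneg {E E' A A' b b' σ σ' c c' ζ ζ' : ℝ}
    (hσ : 0 ≤ σ) (hσA : σ ≤ A) (hAE : A ≤ E) (hζ : 0 ≤ ζ) (hζA : ζ ≤ A) (hζb : ζ ≤ b) (hbE : b ≤ E) (hc : 0 ≤ c) (hcE : c ≤ E)
    (hσ' : 0 ≤ σ') (hσA' : σ' ≤ A') (hAE' : A' ≤ E') (hζ' : 0 ≤ ζ') (hζA' : ζ' ≤ A') (hζb' : ζ' ≤ b') (hbE' : b' ≤ E') (hc' : 0 ≤ c')
    (hcE' : c' ≤ E') :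
    0 ≤ E * E' + A * A' + (b - σ) * (b' - σ') + (c - ζ) * (c' - ζ') := by
  rw [crossing_identity_one_sided]
  have hb : 0 ≤ b := hζ.trans hζb
  have hb' : 0 ≤ b' := hζ'.trans hζb'
  have h1 : 0 ≤ b * (A' - σ') := mul_nonneg hb (by linarith)
  have h2 : 0 ≤ b' * (A - σ) := mul_nonneg hb' (by linarith)
  have h3 : 0 ≤ σ * σ' := mul_nonneg hσ hσ'
  have h4 : 0 ≤ c * c' := mul_nonneg hc hc'
  have h5 : 0 ≤ ζ * (E' - c') := mul_nonneg hζ (by linarith)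
  have h6 : 0 ≤ ζ' * (E - c) := mul_nonneg hζ' (by linarith)
  have h7 : 0 ≤ (E - b) * (A' - ζ') := mul_nonneg (by linarith) (by linarith)
  have h8 : 0 ≤ (E' - b') * (A - ζ) := mul_nonneg (by linarith) (by linarith)
  have h9 : 0 ≤ (E - A) * (E' - A') := mul_nonneg (by linarith) (by linarith)
  have h10 : 0 ≤ (b - ζ) * (b' - ζ') := mul_nonneg (by linarith) (by linarith)
  linarith

/-- **Reduced four-term identity** (gen 46; kit j208223): a REDUCED arc `(E − σ)(E' − σ')` (what the chain identity leaves of the top arc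
after paying a chain whose largest small side has value `σ`) together with a small arc `A` pays a cross pair `(C, z)` whose big side
contains `s`:
`(E − σ)(E' − σ') + A A' + (c − ζ)(c' − ζ') = c (A' − ζ') + c' (A − ζ) + ζ ζ' + (E − A)(E' − A') + (A − σ)(E' − c') + (A' − σ')(E − c) + (c − σ)(c' − σ')`.
The mechanism is the split `E − σ = (E − A) + (A − σ)` into two legitimate gaps (`s ⊆ A ⊆ E`). [this work] -/
theorem reduced_four_term (E E' A A' c c' ζ ζ' σ σ' : ℝ) :
    (E - σ) * (E' - σ') + A * A' + (c - ζ) * (c' - ζ')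
      = c * (A' - ζ') + c' * (A - ζ) + ζ * ζ' + (E - A) * (E' - A') + (A - σ) * (E' - c') + (A' - σ') * (E - c)
        + (c - σ) * (c' - σ') := by
  ring

/-- Nonnegativity from the reduced four-term identity: `0 ≤ (E − σ)(E' − σ') + A A' + (c − ζ)(c' − ζ')` when `0 ≤ ζ ≤ A`,
`σ ≤ A ≤ E`, `σ ≤ c ≤ E`, `0 ≤ c` (same with primes). [this work] -/
theorem reduced_four_term_nonneg {E E' A A' c c' ζ ζ' σ σ' : ℝ}
    (hζ : 0 ≤ ζ) (hζA : ζ ≤ A) (hσA : σ ≤ A) (hAE : A ≤ E) (hσc : σ ≤ c) (hcE : c ≤ E) (hc : 0 ≤ c)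
    (hζ' : 0 ≤ ζ') (hζA' : ζ' ≤ A') (hσA' : σ' ≤ A') (hAE' : A' ≤ E') (hσc' : σ' ≤ c') (hcE' : c' ≤ E') (hc' : 0 ≤ c') :
    0 ≤ (E - σ) * (E' - σ') + A * A' + (c - ζ) * (c' - ζ') := by
  rw [reduced_four_term]
  have h1 : 0 ≤ c * (A' - ζ') := mul_nonneg hc (by linarith)
  have h2 : 0 ≤ c' * (A - ζ) := mul_nonneg hc' (by linarith)
  have h3 : 0 ≤ ζ * ζ' := mul_nonneg hζ hζ'
  have h4 : 0 ≤ (E - A) * (E' - A') := mul_nonneg (by linarith) (by linarith)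
  have h5 : 0 ≤ (A - σ) * (E' - c') := mul_nonneg (by linarith) (by linarith)
  have h6 : 0 ≤ (A' - σ') * (E - c) := mul_nonneg (by linarith) (by linarith)
  have h7 : 0 ≤ (c - σ) * (c' - σ') := mul_nonneg (by linarith) (by linarith)
  linarith

end ChainCert

end Antithetic

end Summit.CriticalPhenomena.PercolationContinuityZ3.Theorems
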